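import Literature.NumberTheory.Rogawski1990.ArchCentralLimitFormulaOfLimitExists     -- ★ p846447∕p846458 (F0P3a-p09 (g2)): FILE A∕B of «A6′» — wall twin, diagonal step, chart∕line dictionary, frame transport; brings ★ (o4) CornerValueFromBall, ★ (o4′) BallExportAdapter
import Literature.NumberTheory.Rogawski1990.ArchCentralLimitChamberSmooth            -- ★ (F0P3a-p02 (g12)): `exists_contDiffOn_letterIntegrand_angleChart_chamber_ball`; brings ★ the jet sockets (`…_local`)
import HarnessLib

/-!
# ROAD «A6-IV» brick (f2), FILE 1 — THE VALUE OF A CORNER JET LIMIT ON A `θ₂`-MINIMAL CHAMBER: every chamber limit `J` of the third jet of `F_Θ∘chart_ζ` within `C_σ`, `σ 0 = 2`, has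
# `Λ(J) = −(c·i)·Θ(ζ•1)` (Rogawski 1990 §8.4 pp. 126–127, Prop. 8.4.1(b); Harish-Chandra [H₂] L. 17.5; Warner II §8.5.1 «the manner in which the point is approached is immaterial»)

Topic `NumberTheory/Rogawski1990`; namespace `Literature.NumberTheory.Rogawski1990`.  THEOREMS ONLY (no `def`, no instance, no notation, no axiom, no named fact, no `sorry`).
Cell `pub/hodgecm-mathlib`, ENGINE T1 (crux H413 = `stmt-HodgeConjecture-24833`); ROAD A (N1 = `stub_L21`; after closer ED. 35 the one print row is (A6-lim) `stub_A6lim`), design of record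
`DESIGN-A6-InHouse-v2-ArchitectureIV` 93542b84 §2 (f2) (owner∕architect F0P3a-p05 (g15), R-15.10 (1) «(f1)(f2) = p02»); pen F0P3a-p02 (g15), 2026-09-01.

THE POINT.  ★ (f1) `ArchCentralLimitFormulaRankTwo.of_liePhiJetBounds_of_values` (p846633) reduces the letter at an e-pattern frame to Harish-Chandra's jet bounds for `φ_f` on the six chambers
((d2)) AND the socket's VALUE CLAUSE: for every chamber `σ` and every `J` with `D³(F_Θ∘chart_ζ) → J` within `C_σ` at the corner, `Λ(J) := (1∕48) Σ_ε ε₀ε₁ε₂·J[v_ε³] = −(c·i)·Θ(ζ•1)`.  THIS FILE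
pays that clause on the two `θ₂`-MINIMAL chambers (`σ 0 = 2`) from W6-core alone — it is ★ p09's `centralLimit_eq_of_ball_of_tendsto` with the letter's regular-set filter replaced by ONE chamber:
(§3) `J` ⇒ `Λ₈[F_Θ](ζe^{iθ}) → Λ(J)` within `C_σ` (★ socket `tendsto_lambda8_angleChart_nhdsWithin_chamber_of_tendsto_iteratedFDeriv_local` over ★ (A1) chamber smoothness, read in line form by
★ `lambda8_angleChart_eq_lambda8Line`); (§4) ⇒ the same limit along the compact wall `tA⃗`, `t → 0⁺` (★ `tendsto_lambda8Line_wall_orbital`, the diagonal step) ⇒ `Λ(J) = −(2∕3)i·ψ₁″ − (1∕2)i·ψ₁(0) +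
(1∕12)i·χ₁″` for the transported, `K`-averaged W6 germs (★ `eq_wallGermValue_of_tendsto_lambda8Line_wall_orbital`, ★ frame `e : G_w ≃ₜ* U(2,1)`, ★ `kMass_mul_orbital_eq_orbital_kAverage`) `= −(c·i)·Θ(ζ•1)`.
HEADS: **`chamberValue_min_of_ball`** (input = ★ (o4)'s ball statement `hBall`) and **`chamberValue_min_of_core`** (input = W6-core's `hcore` = ★ `stub_W6core` text, via ★ `ballWallValue_of_core`);
ONE `c` per `ν` for all `Θ, ζ`, both `θ₂`-minimal chambers and all `J`.  The `θ₂`-maximal pair follows by the inversion symmetry (FILE 2), the two doubly-noncompact chambers by (h4) in jet form (FILE 3).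
HONEST LABEL: HC_CM is proved only modulo the printed citations until rung 0 closes; bookkeeping over ★ files toward paying print row #179, pays nothing by itself.

## References
* [Rogawski1990] J. D. Rogawski, *Automorphic Representations of Unitary Groups in Three Variables*, Ann. of Math. Stud. 123 (1990), §8.4 pp. 126–127; Prop. 8.4.1(b).
* [HarishChandra1975HARRG1] Harish-Chandra, *Harmonic analysis on real reductive groups I*, J. Funct. Anal. 19 (1975), §17 Lemma 17.5.
* [WarnerHASSLG2] G. Warner, *Harmonic Analysis on Semi-Simple Lie Groups II* (1972), §8.5.1 (proof of Thm. 8.5.1.6).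
* [Varadarajan1989] V. S. Varadarajan, *An Introduction to Harmonic Analysis on Semisimple Lie Groups* (1989), §6.4.
-/

set_option autoImplicit false

noncomputable section

open Filter Topology Set Function Complex MeasureTheory Measure NumberField NumberField.InfinitePlace Matrix MulAction
open scoped ContDiff Matrix MatrixGroups Matrix.Norms.Operator
open Literature.Analysis.Calculus Literature.Topology
open Literature.NumberTheory.Automorphic Literature.NumberTheory.Automorphic.UnitaryGroup
open Literature.Geometry.ComplexHyperbolic Literature.Geometry.ComplexHyperbolic.BallModel

namespace Literature.NumberTheory.Rogawski1990

section ChamberMin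

variable (L : Type) [Field L] (α : Fin 3 → L) (w : {w : InfinitePlace L // IsComplex w})

/-- On the normal ray through the wall point `ζ·(e^{it}, e^{it}, e^{−2it})`, `0 < t ≤ 2`, the points with `|s| < min (3t∕2) (1∕4)` are off the noncompact walls (★ (o4)∕«A6′» FILE B, private there). [folklore] -/
private theorem normalRay_off_noncompact_walls'' (ζ : Circle) {t s : ℝ} (ht : 0 < t) (ht2 : t ≤ 2) (hs : |s| < min (3 * t / 2) (1 / 4)) :
    (fun j : Fin 3 => (fun i : Fin 3 => ζ * Circle.exp ((t • (![1, 1, -2] : Fin 3 → ℝ)) i)) j * Circle.exp (s * (![1, -1, 0] : Fin 3 → ℝ) j)) 0 ≠ (fun j : Fin 3 => (fun i : Fin 3 => ζ * Circle.exp ((t • (![1, 1, -2] : Fin 3 → ℝ)) i)) j * Circle.exp (s * (![1, -1, 0] : Fin 3 → ℝ) j)) 2 ∧ (fun j : Fin 3 => (fun i : Fin 3 => ζ * Circle.exp ((t • (![1, 1, -2] : Fin 3 → ℝ)) i)) j * Circle.exp (s * (![1, -1, 0] : Fin 3 → ℝ) j)) 1 ≠ (fun j : Fin 3 => (fun i :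 Fin 3 => ζ * Circle.exp ((t • (![1, 1, -2] : Fin 3 → ℝ)) i)) j * Circle.exp (s * (![1, -1, 0] : Fin 3 → ℝ) j)) 2 := by
  have hs1 : |s| < 3 * t / 2 := lt_of_lt_of_le hs (min_le_left _ _)
  have hs2 : |s| < 1 / 4 := lt_of_lt_of_le hs (min_le_right _ _)
  have key : ∀ u : ℝ, |u| < 1 / 4 → |u| < 3 * t / 2 → ζ * Circle.exp t * Circle.exp u ≠ ζ * Circle.exp (-(t * 2)) * Circle.exp 0 := by
    intro u hu hu'
    have hu1 := abs_lt.mp hu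
    have hu2 := abs_lt.mp hu'
    rw [Circle.exp_zero, mul_one, mul_assoc, ← Circle.exp_add, Ne, mul_right_inj]
    refine circleExp_ne_of_abs_sub_lt_two_pi (by intro h; linarith) ?_
    have hπ : (3.14 : ℝ) < Real.pi := by linarith [Real.pi_gt_d2]
    rw [abs_lt]; constructor <;> nlinarith
  simp only [Pi.smul_apply, smul_eq_mul, Matrix.cons_val_zero, Matrix.cons_val_one, Matrix.cons_val_two, Matrix.tail_cons, Matrix.head_cons,
    mul_one, mul_neg, mul_zero]
  refine ⟨key s hs2 hs1, ?_⟩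
  have := key (-s) (by rwa [abs_neg]) (by rwa [abs_neg])
  simpa only [mul_neg, mul_one] using this

/-- **THE VALUE OF A CORNER JET LIMIT ON A `θ₂`-MINIMAL CHAMBER, from the ball-model statement** (Rogawski 1990 §8.4, Prop. 8.4.1(b) bookkeeping; Harish-Chandra's descent to `U(2,1)`
and averaging over `K = U(2) × U(1)`; Warner's diagonal step).  At a place with `re σ_w(α₀), re σ_w(α₁) > 0 > re σ_w(α₂)`, ★ (o4)'s ball-model hypothesis `hBall` gives: for every Haar
right-invariant `ν` on `G_w` ONE `c > 0` such that for every smooth `Θ` compactly supported on `G_w`, every centre `ζ`, every `θ₂`-MINIMAL chamber `C_σ` (`σ 0 = 2`) and EVERY corner limit `J` of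
the third jet of the letter's `F_Θ∘chart_ζ` within `C_σ`: `(1∕48) Σ_ε ε₀ε₁ε₂·J[v_ε,v_ε,v_ε] = −(c·i)·Θ(ζ•1)` — the value clause of ★ `of_chamberJetBounds_local` ∕ ★ (f1) on those two chambers.
[cite: Rogawski1990, §8.4 pp. 126–127; Prop. 8.4.1(b)] [cite: WarnerHASSLG2, §8.5.1 proof of Thm. 8.5.1.6] [cite: Varadarajan1989, §6.4] -/
theorem chamberValue_min_of_ball (h0 : 0 < (w.1.embedding (α 0)).re) (h1 : 0 < (w.1.embedding (α 1)).re) (h2 : (w.1.embedding (α 2)).re < 0)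
    (hBall : ∀ (μ : Measure BallModel.U21) [μ.IsHaarMeasure],
      ∃ c : ℝ, 0 < c ∧ ∀ (Θ' : Matrix (Fin 3) (Fin 3) ℂ → ℂ), ContDiff ℝ (⊤ : ℕ∞) Θ' →
        HasCompactSupport (fun u : BallModel.U21 => Θ' (BallModel.mat u)) →
        (∀ κ : Matrix (Fin 3) (Fin 3) ℂ, κ * κᴴ = 1 → κ * BallModel.J = BallModel.J * κ → ∀ X, Θ' (κ * X * κᴴ) = Θ' X) →
        ∀ ζ : Circle, ∃ (δ : ℝ) (ψ χ : ℝ → ℂ), 0 < δ ∧ δ ≤ 2 ∧ ContDiffOn ℝ 2 ψ (Icc 0 δ) ∧ ContDiffOn ℝ 2 χ (Icc 0 δ) ∧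
          (∀ t ∈ Ioo 0 δ, ψ t = ((2 - 2 * Real.cos (3 * t) : ℝ) : ℂ) *
            ∫ u, Θ' (BallModel.mat (u * BallModel.mkU21 (Matrix.diagonal fun i => (((fun j : Fin 3 => ζ * Circle.exp ((t • (![1, 1, -2] : Fin 3 → ℝ)) j)) i : Circle) : ℂ)) (BallModel.diagonal_circle_preserves (fun j : Fin 3 => ζ * Circle.exp ((t • (![1, 1, -2] : Fin 3 → ℝ)) j))) * u⁻¹)) ∂μ) ∧
          (∀ t ∈ Ioo 0 δ, χ t = ((2 - 2 * Real.cos (3 * t) : ℝ) : ℂ) ^ 2 * iteratedDeriv 2 (fun s : ℝ =>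
            ∫ u, Θ' (BallModel.mat (u * BallModel.mkU21 (Matrix.diagonal fun i => (((fun j : Fin 3 => (fun i : Fin 3 => ζ * Circle.exp ((t • (![1, 1, -2] : Fin 3 → ℝ)) i)) j * Circle.exp (s * (![1, -1, 0] : Fin 3 → ℝ) j)) i : Circle) : ℂ)) (BallModel.diagonal_circle_preserves (fun j : Fin 3 => (fun i : Fin 3 => ζ * Circle.exp ((t • (![1, 1, -2] : Fin 3 → ℝ)) i)) j * Circle.exp (s * (![1, -1, 0] : Fin 3 → ℝ) j))) * u⁻¹)) ∂μ) 0) ∧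
          -(2 / 3) * Complex.I * iteratedDerivWithin 2 ψ (Icc 0 δ) 0 - (1 / 2) * Complex.I * ψ 0 + (1 / 12) * Complex.I * iteratedDerivWithin 2 χ (Icc 0 δ) 0 =
            -((c : ℂ) * Complex.I) * Θ' ((circleDiagonal 3 (fun _ => ζ) : GL (Fin 3) ℂ) : Matrix (Fin 3) (Fin 3) ℂ)) :
    ∀ [MeasurableSpace (archLocal L 3 (Matrix.diagonal α) w)] [BorelSpace (archLocal L 3 (Matrix.diagonal α) w)],
      (∀ i, α i ≠ 0) → (∀ i, (w.1.embedding (α i)).im = 0) →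
      ∀ (ν : Measure (archLocal L 3 (Matrix.diagonal α) w)) [ν.IsHaarMeasure] [ν.IsMulRightInvariant],
      ∃ c : ℝ, 0 < c ∧
        ∀ (Θ : Matrix (Fin 3) (Fin 3) ℂ → ℂ), ContDiff ℝ (⊤ : ℕ∞) Θ →
          HasCompactSupport (fun k : archLocal L 3 (Matrix.diagonal α) w => Θ ((k : GL (Fin 3) ℂ) : Matrix (Fin 3) (Fin 3) ℂ)) →
          ∀ (ζ : Circle) (σ : Equiv.Perm (Fin 3)), σ 0 = 2 → ∀ J : ContinuousMultilinearMap ℝ (fun _ : Fin 3 => Fin 3 → ℝ) ℂ,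
            Tendsto (iteratedFDeriv ℝ 3 (fun θ : Fin 3 → ℝ => ((((ζ * Circle.exp (θ 0) : Circle) : ℂ)) * (((ζ * Circle.exp (θ 2) : Circle) : ℂ))⁻¹) * ((1 - (((ζ * Circle.exp (θ 1) : Circle) : ℂ)) * (((ζ * Circle.exp (θ 0) : Circle) : ℂ))⁻¹) * (1 - (((ζ * Circle.exp (θ 2) : Circle) : ℂ)) * (((ζ * Circle.exp (θ 1) : Circle) : ℂ))⁻¹) * (1 - (((ζ * Circle.exp (θ 2) : Circle) : ℂ)) * (((ζ * Circle.exp (θ 0) : Circle) : ℂ))⁻¹)) * (∫ g, Θ (((g * ⟨circleDiagonal 3 (fun k => ζ * Circle.exp (θ k)), circleDiagonal_mem_archLocal_diagonal L 3 α w _⟩ * g⁻¹ : archLocal L 3 (Matrix.diagonal α) w) : GL (Fin 3) ℂ) : Matrix (Fin 3) (Fin 3) ℂ) ∂ν))) (𝓝[{θ : Fin 3 → ℝ | θ (σ 0) < θ (σ 1) ∧ θ (σ 1) < θ (σ 2)}] 0) (𝓝 J) →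
              (1 / 48 : ℂ) * ∑ ε : Fin 3 → Bool, ((((if ε 0 then (1 : ℝ) else -1) * (if ε 1 then (1 : ℝ) else -1) * (if ε 2 then (1 : ℝ) else -1) : ℝ)) : ℂ) * J (fun _ : Fin 3 => ![(if ε 0 then (1 : ℝ) else -1) + (if ε 1 then (1 : ℝ) else -1), -(if ε 0 then (1 : ℝ) else -1) + (if ε 2 then (1 : ℝ) else -1), -(if ε 1 then (1 : ℝ) else -1) - (if ε 2 then (1 : ℝ) else -1)]) =
                -((c : ℂ) * Complex.I) * Θ ((circleDiagonal 3 (fun _ => ζ) : GL (Fin 3) ℂ) : Matrix (Fin 3) (Fin 3) ℂ) := by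
  intro _ _ hα hreal ν _ _
  classical
  have hcpt : 0 < (w.1.embedding (α 0)).re * (w.1.embedding (α 1)).re := mul_pos h0 h1
  obtain ⟨T, e, -, he, hez⟩ := exists_continuousMulEquiv_archLocal_U21_torus L α w hreal h0 h1 h2
  haveI : (ν.map e).IsHaarMeasure := isHaarMeasure_map_archLocalEquiv L α w e ν
  obtain ⟨c, hc, hB⟩ := hBall (ν.map e)
  refine ⟨c, hc, fun Θ hΘ hΘc ζ σ hσ J hJ => ?_⟩
  -- (2)+(3) the transported, `K`-averaged test function `Θ′ = (Θ∘Ad T)^K` (kept opaque behind `hΘ'`)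
  obtain ⟨Θ', hΘ'⟩ : ∃ Θ' : Matrix (Fin 3) (Fin 3) ℂ → ℂ, Θ' = fun X => ∫ k : stabilizer U21 x₀,
      Θ ((T : Matrix (Fin 3) (Fin 3) ℂ) * (mat (k : U21) * X * mat ((k⁻¹ : stabilizer U21 x₀) : U21)) * ((T⁻¹ : GL (Fin 3) ℂ) : Matrix (Fin 3) (Fin 3) ℂ)) ∂haar := ⟨_, rfl⟩
  have hΘTd : ContDiff ℝ ∞ fun M : Matrix (Fin 3) (Fin 3) ℂ => Θ ((T : Matrix (Fin 3) (Fin 3) ℂ) * M * ((T⁻¹ : GL (Fin 3) ℂ) : Matrix (Fin 3) (Fin 3) ℂ)) :=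
    contDiff_comp_conjFrame T hΘ
  have hΘTc : HasCompactSupport fun u : U21 => Θ ((T : Matrix (Fin 3) (Fin 3) ℂ) * mat u * ((T⁻¹ : GL (Fin 3) ℂ) : Matrix (Fin 3) (Fin 3) ℂ)) :=
    hasCompactSupport_comp_conjFrame L α w T e he hΘc
  have hΘ'd : ContDiff ℝ (⊤ : ℕ∞) Θ' := by
    rw [hΘ']
    exact contDiff_kAverage (fun M : Matrix (Fin 3) (Fin 3) ℂ => Θ ((T : Matrix (Fin 3) (Fin 3) ℂ) * M * ((T⁻¹ : GL (Fin 3) ℂ) : Matrix (Fin 3) (Fin 3) ℂ))) hΘTd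
  have hΘ'c : HasCompactSupport fun u : U21 => Θ' (mat u) := by
    rw [hΘ']
    exact hasCompactSupport_kAverage_comp_mat (fun M : Matrix (Fin 3) (Fin 3) ℂ => Θ ((T : Matrix (Fin 3) (Fin 3) ℂ) * M * ((T⁻¹ : GL (Fin 3) ℂ) : Matrix (Fin 3) (Fin 3) ℂ))) hΘTc
  have hΘ'K : ∀ κ : Matrix (Fin 3) (Fin 3) ℂ, κ * κᴴ = 1 → κ * BallModel.J = BallModel.J * κ → ∀ X, Θ' (κ * X * κᴴ) = Θ' X := by
    intro κ hκ hκJ X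
    rw [hΘ']
    exact kAverage_conj_of_unitary_comm_J (fun M : Matrix (Fin 3) (Fin 3) ℂ => Θ ((T : Matrix (Fin 3) (Fin 3) ℂ) * M * ((T⁻¹ : GL (Fin 3) ℂ) : Matrix (Fin 3) (Fin 3) ℂ))) hκ hκJ X
  obtain ⟨δ, ψ, χ, hδ, hδ2, hψ, hχ, hψdef, hχdef, hval⟩ := hB Θ' hΘ'd hΘ'c hΘ'K ζ
  -- the mass `m_K > 0` of `K`, the centre, the orbital identity
  obtain ⟨m, hm⟩ : ∃ m : ℝ, m = (haar : Measure (stabilizer U21 x₀)).real univ := ⟨_, rfl⟩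
  have hm0 : 0 < m := by rw [hm]; exact measureReal_univ_pos
  have hmC : (m : ℂ) ≠ 0 := by exact_mod_cast hm0.ne'
  have hcen : Θ' ((circleDiagonal 3 (fun _ => ζ) : GL (Fin 3) ℂ) : Matrix (Fin 3) (Fin 3) ℂ) = (m : ℂ) * Θ ((circleDiagonal 3 (fun _ => ζ) : GL (Fin 3) ℂ) : Matrix (Fin 3) (Fin 3) ℂ) := by
    rw [hΘ', hm]
    exact kAverage_comp_conjFrame_circleDiagonal_const T Θ ζ
  -- the `G_w` torus orbital integral `Φ` (kept opaque behind `hΦ`)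
  obtain ⟨Φ, hΦ⟩ : ∃ Φ : (Fin 3 → Circle) → ℂ, Φ = fun z : Fin 3 → Circle => ∫ g, Θ (((g * ⟨circleDiagonal 3 z, circleDiagonal_mem_archLocal_diagonal L 3 α w z⟩ * g⁻¹ : archLocal L 3 (Matrix.diagonal α) w) : GL (Fin 3) ℂ) : Matrix (Fin 3) (Fin 3) ℂ) ∂ν := ⟨_, rfl⟩
  have horb : ∀ z : Fin 3 → Circle, z 0 ≠ z 2 → z 1 ≠ z 2 →
      (m : ℂ) * Φ z = ∫ u, Θ' (BallModel.mat (u * BallModel.mkU21 (Matrix.diagonal fun i => (((z) i : Circle) : ℂ)) (BallModel.diagonal_circle_preserves (z)) * u⁻¹)) ∂(ν.map e) := by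
    intro z hz02 hz12
    rw [hΦ, hΘ', hm]
    beta_reduce
    exact kMass_mul_orbital_eq_orbital_kAverage L α w hα hreal hcpt T e he hez ν Θ hΘ.continuous hΘc z hz02 hz12
  -- (4) the germs `ψ₁ = m_K⁻¹ψ`, `χ₁ = m_K⁻¹χ` (opaque behind `hψ₁e`, `hχ₁e`) are (A4)-I wall germs for `Φ` on `[0, δ]`
  obtain ⟨ψ₁, hψ₁e⟩ : ∃ ψ₁ : ℝ → ℂ, ψ₁ = fun t : ℝ => (m : ℂ)⁻¹ * ψ t := ⟨_, rfl⟩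
  obtain ⟨χ₁, hχ₁e⟩ : ∃ χ₁ : ℝ → ℂ, χ₁ = fun t : ℝ => (m : ℂ)⁻¹ * χ t := ⟨_, rfl⟩
  have hψ₁ : ContDiffOn ℝ 2 ψ₁ (Icc 0 δ) := hψ₁e ▸ contDiffOn_const.mul hψ
  have hχ₁ : ContDiffOn ℝ 2 χ₁ (Icc 0 δ) := hχ₁e ▸ contDiffOn_const.mul hχ
  have hψdef₁ : ∀ t ∈ Ioo 0 δ, ψ₁ t = ((2 - 2 * Real.cos (3 * t) : ℝ) : ℂ) * Φ (fun j : Fin 3 => ζ * Circle.exp ((t • (![1, 1, -2] : Fin 3 → ℝ)) j)) := by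
    intro t ht
    have hoff := wallPoint_off_noncompact_walls ζ ht.1.ne' (by rw [abs_of_pos ht.1]; exact (ht.2.trans_le hδ2).le)
    rw [hψ₁e]
    beta_reduce
    rw [hψdef t ht, ← horb _ hoff.1 hoff.2, mul_left_comm, inv_mul_cancel_left₀ hmC]
  have hχdef₁ : ∀ t ∈ Ioo 0 δ, χ₁ t = ((2 - 2 * Real.cos (3 * t) : ℝ) : ℂ) ^ 2 *
      iteratedDeriv 2 (fun s : ℝ => Φ (fun j : Fin 3 => (fun i : Fin 3 => ζ * Circle.exp ((t • (![1, 1, -2] : Fin 3 → ℝ)) i)) j * Circle.exp (s * (![1, -1, 0] : Fin 3 → ℝ) j))) 0 := by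
    intro t ht
    have ht2 : t ≤ 2 := (ht.2.trans_le hδ2).le
    -- near `s = 0` the normal ray is off the noncompact walls, so the orbital identity holds there
    have hr : 0 < min (3 * t / 2) (1 / 4) := lt_min (by linarith [ht.1]) (by norm_num)
    have hnear : ∀ᶠ s : ℝ in 𝓝 0, |s| < min (3 * t / 2) (1 / 4) := by
      filter_upwards [Ioo_mem_nhds (neg_lt_zero.mpr hr) hr] with s hs using abs_lt.mpr hs
    have hEq : (fun s : ℝ => ∫ u, Θ' (BallModel.mat (u * BallModel.mkU21 (Matrix.diagonal fun i => (((fun j : Fin 3 => (fun i : Fin 3 => ζ * Circle.exp ((t • (![1, 1, -2] : Fin 3 → ℝ)) i)) j * Circle.exp (s * (![1, -1, 0] : Fin 3 → ℝ) j)) i : Circle) : ℂ)) (BallModel.diagonal_circle_preserves (fun j : Fin 3 => (fun i : Fin 3 => ζ * Circle.exp ((t • (![1, 1, -2] : Fin 3 → ℝ)) i)) j * Circle.exp (s * (![1, -1, 0] : Fin 3 → ℝ) j))) * u⁻¹)) ∂(ν.map e)) =ᶠ[𝓝 0]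
        (fun s : ℝ => (m : ℂ) * Φ (fun j : Fin 3 => (fun i : Fin 3 => ζ * Circle.exp ((t • (![1, 1, -2] : Fin 3 → ℝ)) i)) j * Circle.exp (s * (![1, -1, 0] : Fin 3 → ℝ) j))) := by
      filter_upwards [hnear] with s hs
      have hoff := normalRay_off_noncompact_walls'' ζ ht.1 ht2 hs
      rw [horb _ hoff.1 hoff.2]
    rw [hχ₁e]
    beta_reduce
    rw [hχdef t ht, hEq.iteratedDeriv_eq 2, iteratedDeriv_const_mul_field, mul_left_comm, inv_mul_cancel_left₀ hmC]
  -- §3: the corner jet limit `J` within `C_σ` ⇒ the 8-ray functional of `F_Θ∘chart_ζ` tends to `Λ(J)` within `C_σ` (★ socket §4, chart form), read in LINE form (★ `lambda8_angleChart_eq_lambda8Line`)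
  obtain ⟨r, hr, hF3⟩ := exists_contDiffOn_letterIntegrand_angleChart_chamber_ball L α w hα hreal ν Θ hΘ hΘc ζ σ 3
  have hchart := tendsto_lambda8_angleChart_nhdsWithin_chamber_of_tendsto_iteratedFDeriv_local (fun r : Fin 3 → Circle => ((((r 0 : Circle) : ℂ)) * (((r 2 : Circle) : ℂ))⁻¹) * ((1 - (((r 1 : Circle) : ℂ)) * (((r 0 : Circle) : ℂ))⁻¹) * (1 - (((r 2 : Circle) : ℂ)) * (((r 1 : Circle) : ℂ))⁻¹) * (1 - (((r 2 : Circle) : ℂ)) * (((r 0 : Circle) : ℂ))⁻¹)) * (∫ g, Θ (((g * ⟨circleDiagonal 3 r, circleDiagonal_mem_archLocal_diagonal L 3 α w _⟩ * g⁻¹ : archLocal L 3 (Matrix.diagonal α) w) : GL (Fin 3) ℂ) : Matrix (Fin 3) (Fin 3) ℂ) ∂ν)) ζ σ hr hF3 J hJ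
  have hline : Tendsto (fun x : Fin 3 → ℝ => (1 / 48 : ℂ) * ∑ ε : Fin 3 → Bool, ((((if ε 0 then (1 : ℝ) else -1) * (if ε 1 then (1 : ℝ) else -1) * (if ε 2 then (1 : ℝ) else -1) : ℝ)) : ℂ) *
        iteratedDeriv 3 (fun s : ℝ => (fun θ : Fin 3 → ℝ =>
          (((ζ * Circle.exp (θ 0) : Circle) : ℂ)) * ((((ζ * Circle.exp (θ 2) : Circle) : ℂ)))⁻¹ *
            ((1 - (((ζ * Circle.exp (θ 1) : Circle) : ℂ)) * ((((ζ * Circle.exp (θ 0) : Circle) : ℂ)))⁻¹) *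
              (1 - (((ζ * Circle.exp (θ 2) : Circle) : ℂ)) * ((((ζ * Circle.exp (θ 1) : Circle) : ℂ)))⁻¹) *
              (1 - (((ζ * Circle.exp (θ 2) : Circle) : ℂ)) * ((((ζ * Circle.exp (θ 0) : Circle) : ℂ)))⁻¹)) *
            Φ (fun j => ζ * Circle.exp (θ j)))
          (x + s • (![(if ε 0 then (1 : ℝ) else -1) + (if ε 1 then (1 : ℝ) else -1), -(if ε 0 then (1 : ℝ) else -1) + (if ε 2 then (1 : ℝ) else -1),
            -(if ε 1 then (1 : ℝ) else -1) - (if ε 2 then (1 : ℝ) else -1)] : Fin 3 → ℝ))) 0)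
      (𝓝[{θ : Fin 3 → ℝ | θ (σ 0) < θ (σ 1) ∧ θ (σ 1) < θ (σ 2)}] 0) (𝓝 ((1 / 48 : ℂ) * ∑ ε : Fin 3 → Bool, ((((if ε 0 then (1 : ℝ) else -1) * (if ε 1 then (1 : ℝ) else -1) * (if ε 2 then (1 : ℝ) else -1) : ℝ)) : ℂ) * J (fun _ : Fin 3 => ![(if ε 0 then (1 : ℝ) else -1) + (if ε 1 then (1 : ℝ) else -1), -(if ε 0 then (1 : ℝ) else -1) + (if ε 2 then (1 : ℝ) else -1), -(if ε 1 then (1 : ℝ) else -1) - (if ε 2 then (1 : ℝ) else -1)]))) := by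
    rw [hΦ]
    refine hchart.congr' (Eventually.of_forall fun θ => ?_)
    exact lambda8_angleChart_eq_lambda8Line (fun r : Fin 3 → Circle => ((((r 0 : Circle) : ℂ)) * (((r 2 : Circle) : ℂ))⁻¹) * ((1 - (((r 1 : Circle) : ℂ)) * (((r 0 : Circle) : ℂ))⁻¹) * (1 - (((r 2 : Circle) : ℂ)) * (((r 1 : Circle) : ℂ))⁻¹) * (1 - (((r 2 : Circle) : ℂ)) * (((r 0 : Circle) : ℂ))⁻¹)) * (∫ g, Θ (((g * ⟨circleDiagonal 3 r, circleDiagonal_mem_archLocal_diagonal L 3 α w _⟩ * g⁻¹ : archLocal L 3 (Matrix.diagonal α) w) : GL (Fin 3) ℂ) : Matrix (Fin 3) (Fin 3) ℂ) ∂ν)) ζ θ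
  -- §4: the wall limit, then the value
  haveI : IsFiniteMeasureOnCompacts ν := inferInstance
  have hwallLim := tendsto_lambda8Line_wall_orbital L α w hα hreal hcpt ν Θ hΘ hΘc ζ Φ hΦ σ hσ hline
  obtain ⟨hval₁, -, -⟩ := eq_wallGermValue_of_tendsto_lambda8Line_wall_orbital L α w hα hreal hcpt ν Θ hΘ hΘc ζ Φ hΦ hδ hδ2 hψ₁ hχ₁ hψdef₁ hχdef₁ hwallLim
  refine hval₁.trans ?_
  rw [hψ₁e, hχ₁e, iteratedDerivWithin_const_mul_field, iteratedDerivWithin_const_mul_field]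
  rw [hcen] at hval
  beta_reduce
  calc -(2 / 3) * Complex.I * ((m : ℂ)⁻¹ * iteratedDerivWithin 2 ψ (Icc 0 δ) 0) - (1 / 2) * Complex.I * ((m : ℂ)⁻¹ * ψ 0) +
        (1 / 12) * Complex.I * ((m : ℂ)⁻¹ * iteratedDerivWithin 2 χ (Icc 0 δ) 0)
      = (m : ℂ)⁻¹ * (-(2 / 3) * Complex.I * iteratedDerivWithin 2 ψ (Icc 0 δ) 0 - (1 / 2) * Complex.I * ψ 0 + (1 / 12) * Complex.I * iteratedDerivWithin 2 χ (Icc 0 δ) 0) := by ring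
    _ = (m : ℂ)⁻¹ * (-((c : ℂ) * Complex.I) * ((m : ℂ) * Θ ((circleDiagonal 3 (fun _ => ζ) : GL (Fin 3) ℂ) : Matrix (Fin 3) (Fin 3) ℂ))) := by rw [hval]
    _ = -((c : ℂ) * Complex.I) * Θ ((circleDiagonal 3 (fun _ => ζ) : GL (Fin 3) ℂ) : Matrix (Fin 3) (Fin 3) ℂ) := by
      field_simp

/-- **THE VALUE OF A CORNER JET LIMIT ON A `θ₂`-MINIMAL CHAMBER, from W6-core's `hcore`** (★ `stub_W6core` of «SdArch» ED. 5, text VERBATIM; ★ `ballWallValue_of_core` turns it into `hBall`).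
[cite: Rogawski1990, §8.4 pp. 126–127; Prop. 8.4.1(b)] [cite: HarishChandra1975HARRG1, §17 Lemma 17.5] -/
theorem chamberValue_min_of_core (h0 : 0 < (w.1.embedding (α 0)).re) (h1 : 0 < (w.1.embedding (α 1)).re) (h2 : (w.1.embedding (α 2)).re < 0)
    (hcore : ∀ (μ : Measure BallModel.U21) [μ.IsHaarMeasure],
      ∃ c : ℝ, 0 < c ∧ ∀ (Θ : Matrix (Fin 3) (Fin 3) ℂ → ℂ), ContDiff ℝ (⊤ : ℕ∞) Θ → HasCompactSupport Θ →
        (∀ κ : Matrix (Fin 3) (Fin 3) ℂ, κ * κᴴ = 1 → κ * BallModel.J = BallModel.J * κ → ∀ X, Θ (κ * X * κᴴ) = Θ X) →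
        ∀ ζ : Circle, ∃ (δ : ℝ) (ψ χ : ℝ → ℂ), 0 < δ ∧ δ ≤ 2 ∧ ContDiffOn ℝ 2 ψ (Icc 0 δ) ∧ ContDiffOn ℝ 2 χ (Icc 0 δ) ∧
          (∀ t ∈ Ioo 0 δ, (2 - 2 * Real.cos (3 * t)) • (∫ g, Θ (BallModel.mat (g * BallModel.mkU21 (Matrix.diagonal ![((ζ * Circle.exp t : Circle) : ℂ), ((ζ * Circle.exp t : Circle) : ℂ), ((ζ * Circle.exp (-2 * t) : Circle) : ℂ)]) (BallModel.diagonal_uuv_preserves (ζ * Circle.exp t) (ζ * Circle.exp (-2 * t))) * g⁻¹)) ∂μ) = ψ t) ∧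
          (∀ t ∈ Ioo 0 δ, ‖((ζ * Circle.exp (-2 * t) : Circle) : ℂ) - ((ζ * Circle.exp t : Circle) : ℂ)‖ ^ 4 •
            iteratedDeriv 2 (fun y : ℝ => ∫ u : BallModel.U21, Θ (BallModel.mat u * Matrix.diagonal (fun k : Fin 3 => (((![ζ * Circle.exp t, ζ * Circle.exp t, ζ * Circle.exp (-2 * t)] : Fin 3 → Circle) k * Circle.exp (y * ((if k = (0 : Fin 3) then (1 : ℝ) else 0) - (if k = (1 : Fin 3) then (1 : ℝ) else 0))) : Circle) : ℂ)) * BallModel.mat u⁻¹) ∂μ) 0 = χ t) ∧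
          -(2 / 3) * Complex.I * iteratedDerivWithin 2 ψ (Icc 0 δ) 0 - (1 / 2) * Complex.I * ψ 0 + (1 / 12) * Complex.I * iteratedDerivWithin 2 χ (Icc 0 δ) 0 =
            -((c : ℂ) * Complex.I) * Θ ((ζ : ℂ) • (1 : Matrix (Fin 3) (Fin 3) ℂ))) :
    ∀ [MeasurableSpace (archLocal L 3 (Matrix.diagonal α) w)] [BorelSpace (archLocal L 3 (Matrix.diagonal α) w)],
      (∀ i, α i ≠ 0) → (∀ i, (w.1.embedding (α i)).im = 0) →
      ∀ (ν : Measure (archLocal L 3 (Matrix.diagonal α) w)) [ν.IsHaarMeasure] [ν.IsMulRightInvariant],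
      ∃ c : ℝ, 0 < c ∧
        ∀ (Θ : Matrix (Fin 3) (Fin 3) ℂ → ℂ), ContDiff ℝ (⊤ : ℕ∞) Θ →
          HasCompactSupport (fun k : archLocal L 3 (Matrix.diagonal α) w => Θ ((k : GL (Fin 3) ℂ) : Matrix (Fin 3) (Fin 3) ℂ)) →
          ∀ (ζ : Circle) (σ : Equiv.Perm (Fin 3)), σ 0 = 2 → ∀ J : ContinuousMultilinearMap ℝ (fun _ : Fin 3 => Fin 3 → ℝ) ℂ,
            Tendsto (iteratedFDeriv ℝ 3 (fun θ : Fin 3 → ℝ => ((((ζ * Circle.exp (θ 0) : Circle) : ℂ)) * (((ζ * Circle.exp (θ 2) : Circle) : ℂ))⁻¹) * ((1 - (((ζ * Circle.exp (θ 1) : Circle) : ℂ)) * (((ζ * Circle.exp (θ 0) : Circle) : ℂ))⁻¹) * (1 - (((ζ * Circle.exp (θ 2) : Circle) : ℂ)) * (((ζ * Circle.exp (θ 1) : Circle) : ℂ))⁻¹) * (1 - (((ζ * Circle.exp (θ 2) : Circle) : ℂ)) * (((ζ * Circle.exp (θ 0) : Circle) : ℂ))⁻¹)) * (∫ g, Θ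 (((g * ⟨circleDiagonal 3 (fun k => ζ * Circle.exp (θ k)), circleDiagonal_mem_archLocal_diagonal L 3 α w _⟩ * g⁻¹ : archLocal L 3 (Matrix.diagonal α) w) : GL (Fin 3) ℂ) : Matrix (Fin 3) (Fin 3) ℂ) ∂ν))) (𝓝[{θ : Fin 3 → ℝ | θ (σ 0) < θ (σ 1) ∧ θ (σ 1) < θ (σ 2)}] 0) (𝓝 J) →
              (1 / 48 : ℂ) * ∑ ε : Fin 3 → Bool, ((((if ε 0 then (1 : ℝ) else -1) * (if ε 1 then (1 : ℝ) else -1) * (if ε 2 then (1 : ℝ) else -1) : ℝ)) : ℂ) * J (fun _ : Fin 3 => ![(if ε 0 then (1 : ℝ) else -1) + (if ε 1 then (1 : ℝ) else -1), -(if ε 0 then (1 : ℝ) else -1) + (if ε 2 then (1 : ℝ) else -1), -(if ε 1 then (1 : ℝ) else -1) - (if ε 2 then (1 : ℝ) else -1)]) =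
                -((c : ℂ) * Complex.I) * Θ ((circleDiagonal 3 (fun _ => ζ) : GL (Fin 3) ℂ) : Matrix (Fin 3) (Fin 3) ℂ) :=
  chamberValue_min_of_ball L α w h0 h1 h2 (ballWallValue_of_core hcore)

end ChamberMin

end Literature.NumberTheory.Rogawski1990

end
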